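import Summits.FinalStateConjecture.FinalStateConjecture.Theorems.SwallowTheDatumSubdataDevelopmentsEmbedNcbDomain

/-!
# Route SwallowTheDatum · item `SubdataDevelopmentsEmbed` (stmt-FinalStateConjecture-10053) —
# hypothesis (c) (relative "no corresponding boundary points") from the SAME-DATA Theorem 12

Sequel to `…NcbDomain`. For a relative common sub-development `(U, ψ)` of `𝒟'` (sub-datum
`D.comap Φ` on `N`) and `𝒟` (datum `D` on `X`) admitting no proper extension, a cluster point `q`
of `ψ` along `U` at `p ∈ ∂U` lies in the Cauchy piece domain `V` of `ι(Φ N)` (`…NcbDomain`), which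
carries the vacuum development `R = (V, g|, τ|, ι ∘ Φ, ν ∘ Φ)` of the sub-datum; `(U, ψ)` is a
same-data common development of `𝒟'` and `R` (Sbierski 2016, Def. 2.4) with the corresponding pair
`(p, q)` (Def. 11), so Theorem 12 (displayed, `h12`, shape of `MCGHDNoCorrespondingBoundary.lean`)
extends it to `V' > U`; read in `M` through `V ⊆ M` the extension is a relative common
sub-development agreeing with `ψ` on `U` (`IsCommonDevelopment.apply_eq_apply`) — against
maximality (`relCGHD_of_isCommonDevelopment`, `not_clusterPt_of_thm12`); `hncb_of_thm12` is
hypothesis (c) of `…Skeleton2` in its displayed shape, from `h12`, the global-hyperbolicity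
consequences `hGH` (Hawking–Ellis 1973, Prop. 6.6.6; O'Neill 1983, Lemma 14.22) and the slab
condition. Pure composition over the tree; no definitions, no named facts.
-/

noncomputable section

open Function Set Filter Topology TopologicalSpace Bundle
open scoped Manifold ContDiff Topology

namespace Summit.FinalStateConjecture.FinalStateConjecture.Theorems

namespace SubdataDevelopmentsEmbed
open Literature.Geometry.Lorentzian

universe u

variable {n : ℕ}
  {N : Type u} [TopologicalSpace N] [ChartedSpace (EuclideanSpace ℝ (Fin n)) N]
  [IsManifold (𝓡 n) ∞ N] [ConnectedSpace N] {D₁ : InitialDataSet (𝓡 n) N}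
  {X : Type u} [TopologicalSpace X] [ChartedSpace (EuclideanSpace ℝ (Fin n)) X]
  [IsManifold (𝓡 n) ∞ X] [ConnectedSpace X] {D₂ : InitialDataSet (𝓡 n) X}

/-- **A same-data common development `(V', ψ')` of `𝒟'` and a sub-data development `R`, composed
with an isometric, time-orientation preserving, smooth immersion `χ : R → M` over `Φ`
(`χ ∘ ι_R = ι ∘ Φ`), satisfies the seven displayed conjuncts of a relative common sub-development
of `𝒟'` and `𝒟` over `Φ`.** [cite: Sbierski2016AHP, §2, Def. 2.4 (arXiv numbering); HawkingEllis1973CUP, §7.6, p. 250] -/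
theorem relCGHD_of_isCommonDevelopment (𝒟 : VacuumCauchyDevelopment.{u} D₂) {Φ : N → X}
    (hΦ : ContMDiff (𝓡 n) (𝓡 n) (∞ + 1) Φ) (hΦ' : ∀ u, Injective (mfderiv (𝓡 n) (𝓡 n) Φ u))
    (𝒟' R : VacuumCauchyDevelopment.{u} (D₂.comap Φ hΦ hΦ'))
    (χ : R.carrier → 𝒟.carrier) (hχs : ContMDiff (𝓡 (n + 1)) (𝓡 (n + 1)) ∞ χ)
    (hχi : R.metric.IsIsometricImmersion 𝒟.metric.toPseudoRiemannianMetric χ)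
    (hχτ : R.timeOrientation.PreservesTimeOrientation χ 𝒟.timeOrientation)
    (hχe : χ ∘ R.embed = 𝒟.embed ∘ Φ)
    {V' : Opens 𝒟'.carrier} (hV' : 𝒟'.toCauchyDevelopment.IsCommonDevelopment R.toDataEmbedding V')
    {ψ' : V' → R.carrier}
    (hψ'i : (𝒟'.metric.restrict PseudoRiemannianMetric.contMDiff_restrict_holds V').IsIsometricImmersion
      R.metric.toPseudoRiemannianMetric ψ')
    (hψ'τ : (𝒟'.timeOrientation.restrict PseudoRiemannianMetric.contMDiff_restrict_holds
      𝒟'.timeOrientation.contMDiff_restrict_holds V').PreservesTimeOrientation ψ' R.timeOrientation)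
    (hψ'ι : ψ' ∘ 𝒟'.embedOpens V' hV'.embed_mem = R.embed) {ψ'' : 𝒟'.carrier → 𝒟.carrier}
    (hψ'' : ∀ (x : 𝒟'.carrier) (hx : x ∈ V'), ψ'' x = χ (ψ' ⟨x, hx⟩)) :
    (∀ u, 𝒟'.embed u ∈ V') ∧ IsConnected (V' : Set 𝒟'.carrier) ∧
      (𝒟'.metric.restrict PseudoRiemannianMetric.contMDiff_restrict_holds V').IsCauchyHypersurface
        (𝒟'.timeOrientation.restrict PseudoRiemannianMetric.contMDiff_restrict_holds
          𝒟'.timeOrientation.contMDiff_restrict_holds V') (Subtype.val ⁻¹' range 𝒟'.embed) ∧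
      ContMDiffOn (𝓡 (n + 1)) (𝓡 (n + 1)) ∞ ψ'' V' ∧
      (∀ p ∈ V', pullbackBilin (I := 𝓡 (n + 1)) (I' := 𝓡 (n + 1)) ψ'' 𝒟.metric.val p =
        𝒟'.metric.val p) ∧
      (∀ p ∈ V', 𝒟.timeOrientation.IsFutureDirected
        (mfderiv (𝓡 (n + 1)) (𝓡 (n + 1)) ψ'' p (𝒟'.timeOrientation.vectorField p))) ∧
      ψ'' ∘ 𝒟'.embed = 𝒟.embed ∘ Φ := by
  have hψ''val : (fun y : V' ↦ ψ'' y.1) = χ ∘ ψ' := funext fun y ↦ hψ'' y.1 y.2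
  have hψ''s : ∀ x ∈ V', ContMDiffAt (𝓡 (n + 1)) (𝓡 (n + 1)) ∞ ψ'' x := fun x hx ↦ by
    have h : ContMDiffAt (𝓡 (n + 1)) (𝓡 (n + 1)) ∞ (fun y : V' ↦ ψ'' y.1) ⟨x, hx⟩ := by
      rw [hψ''val]
      exact (hχs.comp hψ'i.1) ⟨x, hx⟩
    exact contMDiffAt_subtype_iff.mp h
  have hχd : MDifferentiable (𝓡 (n + 1)) (𝓡 (n + 1)) χ := hχs.mdifferentiable (by simp)
  have hmf'' : ∀ (x : 𝒟'.carrier) (hx : x ∈ V') (v : TangentSpace (𝓡 (n + 1)) x),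
      mfderiv (𝓡 (n + 1)) (𝓡 (n + 1)) ψ'' x v =
        mfderiv (𝓡 (n + 1)) (𝓡 (n + 1)) χ (ψ' ⟨x, hx⟩)
          (mfderiv (𝓡 (n + 1)) (𝓡 (n + 1)) ψ' ⟨x, hx⟩ v) := by
    intro x hx v
    have hd : MDifferentiableAt (𝓡 (n + 1)) (𝓡 (n + 1)) ψ'' x := (hψ''s x hx).mdifferentiableAt (by simp)
    have hdψ' : MDifferentiableAt (𝓡 (n + 1)) (𝓡 (n + 1)) ψ' ⟨x, hx⟩ :=
      (hψ'i.1 ⟨x, hx⟩).mdifferentiableAt (by simp)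
    have h1 := mfderiv_comp_subtypeVal (I' := 𝓡 (n + 1)) (I := 𝓡 (n + 1)) (W := V') (y := ⟨x, hx⟩) hd
    have h2 := mfderiv_comp (⟨x, hx⟩ : V') (hχd (ψ' ⟨x, hx⟩)) hdψ'
    have h5 : mfderiv (𝓡 (n + 1)) (𝓡 (n + 1)) (ψ'' ∘ (Subtype.val : V' → 𝒟'.carrier)) ⟨x, hx⟩ =
        mfderiv (𝓡 (n + 1)) (𝓡 (n + 1)) (χ ∘ ψ') ⟨x, hx⟩ := by
      rw [show ψ'' ∘ (Subtype.val : V' → 𝒟'.carrier) = χ ∘ ψ' from hψ''val]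
    have e1 : (mfderiv (𝓡 (n + 1)) (𝓡 (n + 1)) ψ'' x v : EuclideanSpace ℝ (Fin (n + 1))) =
        mfderiv (𝓡 (n + 1)) (𝓡 (n + 1)) (ψ'' ∘ (Subtype.val : V' → 𝒟'.carrier)) ⟨x, hx⟩ v :=
      (DFunLike.congr_fun h1 v).symm
    have e2 : (mfderiv (𝓡 (n + 1)) (𝓡 (n + 1)) (ψ'' ∘ (Subtype.val : V' → 𝒟'.carrier)) ⟨x, hx⟩ v :
        EuclideanSpace ℝ (Fin (n + 1))) = mfderiv (𝓡 (n + 1)) (𝓡 (n + 1)) (χ ∘ ψ') ⟨x, hx⟩ v :=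
      DFunLike.congr_fun h5 v
    have e3 : (mfderiv (𝓡 (n + 1)) (𝓡 (n + 1)) (χ ∘ ψ') ⟨x, hx⟩ v : EuclideanSpace ℝ (Fin (n + 1))) =
        mfderiv (𝓡 (n + 1)) (𝓡 (n + 1)) χ (ψ' ⟨x, hx⟩)
          (mfderiv (𝓡 (n + 1)) (𝓡 (n + 1)) ψ' ⟨x, hx⟩ v) := DFunLike.congr_fun h2 v
    exact e1.trans (e2.trans e3)
  have hχiso : ∀ (z : R.carrier) (a b : TangentSpace (𝓡 (n + 1)) z),
      𝒟.metric.val (χ z) (mfderiv (𝓡 (n + 1)) (𝓡 (n + 1)) χ z a)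
        (mfderiv (𝓡 (n + 1)) (𝓡 (n + 1)) χ z b) = R.metric.val z a b := fun z a b ↦ by
    have h := congrArg (fun β ↦ β a b) (hχi.2 z)
    simpa only [pullbackBilin_apply] using h
  refine ⟨hV'.embed_mem, hV'.isConnected, hV'.isCauchyHypersurface,
    fun x hx ↦ (hψ''s x hx).contMDiffWithinAt, fun x hx ↦ ?_, fun x hx ↦ ?_, funext fun u ↦ ?_⟩
  · ext v w
    have hk := congrArg (fun b ↦ b v w) (hψ'i.2 ⟨x, hx⟩)
    simp only [pullbackBilin_apply] at hk
    rw [pullbackBilin_apply, hmf'' x hx v, hmf'' x hx w, hψ'' x hx, hχiso]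
    exact hk
  · rw [hmf'' x hx, hψ'' x hx]
    exact hχτ.isFutureDirected_mfderiv hχi.2 (hψ'τ ⟨x, hx⟩)
  · have h := congrFun hψ'ι u
    have h' : ψ' ⟨𝒟'.embed u, hV'.embed_mem u⟩ = R.embed u := h
    show ψ'' (𝒟'.embed u) = (𝒟.embed ∘ Φ) u
    rw [hψ'' _ (hV'.embed_mem u), h', ← hχe]
    rfl

/-- **The relative "no corresponding boundary points" statement from the same-data Theorem 12**
(one configuration; see the module docstring). Displayed: `h12` (Sbierski 2016, Thm. 12 for the
vacuum developments of the sub-datum), the global-hyperbolicity consequences `hK`, `hK'`, `hK₁`,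
`hK₁'`, `hrel`, the slab condition `hslab` of `ι(X)`. [cite: Sbierski2016AHP, §3.2, Def. 11, Thm. 12 and §3.3 (arXiv numbering); HawkingEllis1973CUP, §7.6, p. 250] -/
theorem not_clusterPt_of_thm12
    (𝒟 : VacuumCauchyDevelopment.{u} D₂) {Φ : N → X} (hΦ : ContMDiff (𝓡 n) (𝓡 n) (∞ + 1) Φ)
    (hΦ' : ∀ u, Injective (mfderiv (𝓡 n) (𝓡 n) Φ u)) (hΦo : IsOpenEmbedding Φ)
    (𝒟' : VacuumCauchyDevelopment.{u} (D₂.comap Φ hΦ hΦ'))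
    (h12 : ∀ (R : VacuumCauchyDevelopment.{u} (D₂.comap Φ hΦ hΦ'))
      (𝔠 : CauchyDevelopment.CommonDevelopment 𝒟'.toCauchyDevelopment R.toCauchyDevelopment),
      𝔠.HasCorrespondingBoundaryPoints →
        ∃ V : Opens 𝒟'.carrier,
          𝒟'.toCauchyDevelopment.IsCommonDevelopment R.toDataEmbedding V ∧ 𝔠.opens < V)
    (hK : ∀ x : 𝒟.carrier, IsCompact (𝒟.metric.causalPast 𝒟.timeOrientation {x} ∩
      𝒟.metric.causalFuture 𝒟.timeOrientation (range 𝒟.embed)))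
    (hK' : ∀ x : 𝒟.carrier, IsCompact (𝒟.metric.causalFuture 𝒟.timeOrientation {x} ∩
      𝒟.metric.causalPast 𝒟.timeOrientation (range 𝒟.embed)))
    (hK₁ : ∀ x : 𝒟'.carrier, IsCompact (𝒟'.metric.causalPast 𝒟'.timeOrientation {x} ∩
      𝒟'.metric.causalFuture 𝒟'.timeOrientation (range 𝒟'.embed)))
    (hK₁' : ∀ x : 𝒟'.carrier, IsCompact (𝒟'.metric.causalFuture 𝒟'.timeOrientation {x} ∩
      𝒟'.metric.causalPast 𝒟'.timeOrientation (range 𝒟'.embed)))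
    (hrel : ∀ {xs ys : ℕ → 𝒟.carrier} {x y : 𝒟.carrier}, Tendsto xs atTop (𝓝 x) →
      Tendsto ys atTop (𝓝 y) → (∀ j, ys j ∈ 𝒟.metric.causalFuture 𝒟.timeOrientation {xs j}) →
      y ∈ 𝒟.metric.causalFuture 𝒟.timeOrientation {x})
    (hslab : ∀ a ∈ range 𝒟.embed, ∃ ν : TangentSpace (𝓡 (n + 1)) a,
      𝒟.metric.IsTimelike ν ∧ 𝒟.timeOrientation.IsFutureDirected ν ∧
      ∀ κ : ℝ, 0 < κ → ∀ᶠ σ in 𝓝 a, σ ∈ range 𝒟.embed →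
        |𝒟.metric.val a ν (extChartAt (𝓡 (n + 1)) a σ - extChartAt (𝓡 (n + 1)) a a)| ≤
          κ * ‖extChartAt (𝓡 (n + 1)) a σ - extChartAt (𝓡 (n + 1)) a a‖)
    (U : Opens 𝒟'.carrier) (ψ : 𝒟'.carrier → 𝒟.carrier)
    (hP : (∀ u, 𝒟'.embed u ∈ U) ∧ IsConnected (U : Set 𝒟'.carrier) ∧
      (𝒟'.metric.restrict PseudoRiemannianMetric.contMDiff_restrict_holds U).IsCauchyHypersurface
        (𝒟'.timeOrientation.restrict PseudoRiemannianMetric.contMDiff_restrict_holds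
          𝒟'.timeOrientation.contMDiff_restrict_holds U) (Subtype.val ⁻¹' range 𝒟'.embed) ∧
      ContMDiffOn (𝓡 (n + 1)) (𝓡 (n + 1)) ∞ ψ U ∧
      (∀ p ∈ U, pullbackBilin (I := 𝓡 (n + 1)) (I' := 𝓡 (n + 1)) ψ 𝒟.metric.val p =
        𝒟'.metric.val p) ∧
      (∀ p ∈ U, 𝒟.timeOrientation.IsFutureDirected
        (mfderiv (𝓡 (n + 1)) (𝓡 (n + 1)) ψ p (𝒟'.timeOrientation.vectorField p))) ∧
      ψ ∘ 𝒟'.embed = 𝒟.embed ∘ Φ)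
    (hUmax : ∀ (U' : Opens 𝒟'.carrier) (ψ' : 𝒟'.carrier → 𝒟.carrier),
      ((∀ u, 𝒟'.embed u ∈ U') ∧ IsConnected (U' : Set 𝒟'.carrier) ∧
      (𝒟'.metric.restrict PseudoRiemannianMetric.contMDiff_restrict_holds U').IsCauchyHypersurface
        (𝒟'.timeOrientation.restrict PseudoRiemannianMetric.contMDiff_restrict_holds
          𝒟'.timeOrientation.contMDiff_restrict_holds U') (Subtype.val ⁻¹' range 𝒟'.embed) ∧
      ContMDiffOn (𝓡 (n + 1)) (𝓡 (n + 1)) ∞ ψ' U' ∧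
      (∀ p ∈ U', pullbackBilin (I := 𝓡 (n + 1)) (I' := 𝓡 (n + 1)) ψ' 𝒟.metric.val p =
        𝒟'.metric.val p) ∧
      (∀ p ∈ U', 𝒟.timeOrientation.IsFutureDirected
        (mfderiv (𝓡 (n + 1)) (𝓡 (n + 1)) ψ' p (𝒟'.timeOrientation.vectorField p))) ∧
      ψ' ∘ 𝒟'.embed = 𝒟.embed ∘ Φ) →
      U ≤ U' → EqOn ψ ψ' U → U' = U)
    {p : 𝒟'.carrier} (hp : p ∈ frontier (U : Set 𝒟'.carrier)) (q : 𝒟.carrier) :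
    ¬ ClusterPt q (map ψ (𝓝[(U : Set 𝒟'.carrier)] p)) := by
  intro hq
  obtain ⟨hι, hUc, hC, hs, hi, ht, hc⟩ := hP
  have hpU : p ∉ U := fun h ↦ (eq_empty_iff_forall_notMem.1 U.2.inter_frontier_eq) p ⟨h, hp⟩
  obtain ⟨hqF, hUF, hinjOn, hopen, hcorr⟩ := not_mem_closure_badSet_of_clusterPt 𝒟 hΦ hΦ' hΦo 𝒟'
    hK hK' hK₁ hK₁' hrel hslab U ψ ⟨hι, hUc, hC, hs, hi, ht, hc⟩ hp hq
  obtain ⟨n₀⟩ : Nonempty N := inferInstance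
  obtain ⟨V₁, hV₁, hV₁conn, hι₁, hV₁cl, hV₁C⟩ := exists_cauchyPieceDomain 𝒟 hΦo hslab n₀
  have hψUV : ψ '' (U : Set 𝒟'.carrier) ⊆ (V₁ : Set 𝒟.carrier) := by
    rw [hV₁]
    refine ((hUc.image ψ hs.continuousOn)).isPreconnected.subset_connectedComponentIn
      ⟨𝒟'.embed n₀, hι n₀, congrFun hc n₀⟩ (Set.disjoint_left.1 hUF)
  have hψV : ∀ y : U, ψ y.1 ∈ V₁ := fun y ↦ hψUV ⟨y.1, y.2, rfl⟩
  have hqcl : q ∈ closure (ψ '' (U : Set 𝒟'.carrier)) := by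
    rw [mem_closure_iff_nhds]
    intro V' hV'
    obtain ⟨y, hyU, -, hy⟩ := hcorr univ univ_mem V' hV'
    exact ⟨ψ y, hy, y, hyU, rfl⟩
  have hqV : q ∈ V₁ := hV₁cl ⟨closure_mono hψUV hqcl, hqF⟩
  have hν : ∀ u, MDifferentiableAt (𝓡 n) (𝓡 (n + 1)).tangent
      (fun x ↦ (TotalSpace.mk' (EuclideanSpace ℝ (Fin (n + 1))) (𝒟.embed x) (𝒟.normal x) :
        TangentBundle (𝓡 (n + 1)) 𝒟.carrier)) (Φ u) := fun u ↦
    𝒟.toDataEmbedding.mdifferentiableAt_embed_normal (Φ u)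
  let DE : DataEmbedding (D₂.comap Φ hΦ hΦ') :=
    (𝒟.toDataEmbedding.comapAlong Φ hΦ hΦ' hΦo hν).restrict V₁ hV₁conn hι₁
      (𝒟.toDataEmbedding.mdifferentiableAt_normal_comapAlong hΦ hΦ' hΦo hν)
  have hrange₁ : range (fun u ↦ (⟨𝒟.embed (Φ u), hι₁ u⟩ : V₁)) = Subtype.val ⁻¹' range (𝒟.embed ∘ Φ) := by
    ext z
    constructor
    · rintro ⟨u, rfl⟩
      exact ⟨u, rfl⟩
    · rintro ⟨u, hu⟩
      exact ⟨u, Subtype.ext hu⟩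
  let R : VacuumCauchyDevelopment (D₂.comap Φ hΦ hΦ') :=
    { carrier := V₁
      metric := 𝒟.metric.restrict PseudoRiemannianMetric.contMDiff_restrict_holds V₁
      timeOrientation := 𝒟.timeOrientation.restrict PseudoRiemannianMetric.contMDiff_restrict_holds
        𝒟.timeOrientation.contMDiff_restrict_holds V₁
      connectedSpace := isConnected_iff_connectedSpace.mp hV₁conn
      embed := fun u ↦ ⟨𝒟.embed (Φ u), hι₁ u⟩
      isSmoothEmbedding := DE.isSmoothEmbedding
      normal := fun u ↦ 𝒟.normal (Φ u)
      isFutureUnitNormal := DE.isFutureUnitNormal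
      induced_h := DE.induced_h
      induced_k := by
        intro inst y
        exact @DataEmbedding.induced_k n N _ _ _ _ (D₂.comap Φ hΦ hΦ') DE inst y
      isCauchyHypersurface := hrange₁ ▸ hV₁C
      isRicciFlat := by
        intro inst
        haveI : ((𝒟.toDataEmbedding.comapAlong Φ hΦ hΦ' hΦo hν).metric.restrict
            PseudoRiemannianMetric.contMDiff_restrict_holds V₁).toPseudoRiemannianMetric.HasLeviCivita :=
          inst
        exact (𝒟.toDataEmbedding.comapAlong Φ hΦ hΦ' hΦo hν).isRicciFlat_restrict V₁
          ((𝒟.toDataEmbedding).comapAlong_isVacuum 𝒟.isVacuum) }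
  have hsmooth : ContMDiff (𝓡 (n + 1)) (𝓡 (n + 1)) ∞ (ψ ∘ (Subtype.val : U → 𝒟'.carrier)) :=
    hs.comp_contMDiff contMDiff_subtype_val fun p ↦ p.2
  have hmf : ∀ (y : U) (v : TangentSpace (𝓡 (n + 1)) y),
      mfderiv (𝓡 (n + 1)) (𝓡 (n + 1)) (ψ ∘ (Subtype.val : U → 𝒟'.carrier)) y v =
        mfderiv (𝓡 (n + 1)) (𝓡 (n + 1)) ψ y.1 v := by
    intro y v
    have hd : MDifferentiableAt (𝓡 (n + 1)) (𝓡 (n + 1)) ψ y.1 :=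
      ((hs y.1 y.2).contMDiffAt (U.2.mem_nhds y.2)).mdifferentiableAt (by simp)
    rw [mfderiv_comp y hd
      (hasMFDerivAt_subtypeVal (I' := 𝓡 (n + 1)) (W := U) y).mdifferentiableAt, mfderiv_subtypeVal]
    rfl
  let mapᵥ : U → V₁ := fun y ↦ ⟨ψ y.1, hψV y⟩
  have hvalmapᵥ : (Subtype.val ∘ mapᵥ) = ψ ∘ (Subtype.val : U → 𝒟'.carrier) := rfl
  have hmapᵥs : ContMDiff (𝓡 (n + 1)) (𝓡 (n + 1)) ∞ mapᵥ :=
    (ContMDiff.subtypeVal_comp_iff V₁ mapᵥ).1 (by rw [hvalmapᵥ]; exact hsmooth)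
  have hmfᵥ : ∀ (y : U) (v : TangentSpace (𝓡 (n + 1)) y),
      mfderiv (𝓡 (n + 1)) (𝓡 (n + 1)) mapᵥ y v = mfderiv (𝓡 (n + 1)) (𝓡 (n + 1)) ψ y.1 v := by
    intro y v
    rw [← hmf y v]
    exact mfderiv_codRestrict_opens_apply V₁ (f := ψ ∘ (Subtype.val : U → 𝒟'.carrier)) hψV
      ((hsmooth y).mdifferentiableAt (by simp)) v
  let 𝔞 : CauchyDevelopment.CommonDevelopment 𝒟'.toCauchyDevelopment R.toCauchyDevelopment :=
    { opens := U
      embed_mem := hι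
      isCauchyHypersurface := hC
      map := mapᵥ
      isIsometricImmersion := by
        refine ⟨hmapᵥs, fun (y : U) ↦ ?_⟩
        ext v w
        have hk := congrArg (fun b ↦ b v w) (hi y.1 y.2)
        simp only [pullbackBilin_apply] at hk
        show 𝒟.metric.val (ψ y.1) (mfderiv (𝓡 (n + 1)) (𝓡 (n + 1)) mapᵥ y v)
            (mfderiv (𝓡 (n + 1)) (𝓡 (n + 1)) mapᵥ y w) = 𝒟'.metric.val y.1 v w
        rw [hmfᵥ y v, hmfᵥ y w]
        exact hk
      preservesTimeOrientation := fun (y : U) ↦ by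
        show 𝒟.timeOrientation.IsFutureDirected (x := ψ y.1)
          (mfderiv (𝓡 (n + 1)) (𝓡 (n + 1)) mapᵥ y (𝒟'.timeOrientation.vectorField y.1))
        rw [hmfᵥ]
        exact ht y.1 y.2
      map_comp_embedOpens := funext fun u ↦ Subtype.ext (congrFun hc u) }
  have h𝔞U : 𝒟'.toCauchyDevelopment.IsCommonDevelopment R.toDataEmbedding U :=
    ⟨hι, hC, mapᵥ, 𝔞.isIsometricImmersion, 𝔞.preservesTimeOrientation, 𝔞.map_comp_embedOpens⟩
  have hNᵥ : ∀ V ∈ 𝓝 p, ∀ W' ∈ 𝓝 (⟨q, hqV⟩ : V₁), ∃ y : U, (y : 𝒟'.carrier) ∈ V ∧ mapᵥ y ∈ W' := by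
    intro V hV W' hW'
    have hW'M : Subtype.val '' W' ∈ 𝓝 q := V₁.2.isOpenMap_subtype_val.image_mem_nhds hW'
    obtain ⟨y, hyU, hyV, z, hzW', hz⟩ := hcorr V hV _ hW'M
    refine ⟨⟨y, hyU⟩, hyV, ?_⟩
    have heq : mapᵥ ⟨y, hyU⟩ = z := Subtype.ext hz.symm
    rw [heq]
    exact hzW'
  have hpair : 𝔞.IsCorrespondingPair p ⟨q, hqV⟩ := by
    refine ⟨hp, ⟨?_, ?_⟩, hNᵥ⟩
    · rw [mem_closure_iff_nhds]
      intro W' hW'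
      obtain ⟨y, -, hy⟩ := hNᵥ univ univ_mem W' hW'
      exact ⟨mapᵥ y, hy, y, rfl⟩
    · intro hint
      obtain ⟨y₀, hy₀⟩ := interior_subset hint
      have hqy₀ : ψ y₀.1 = q := congrArg Subtype.val hy₀
      have hpy₀ : p = y₀.1 := by
        by_contra hne
        obtain ⟨A, B, hA, hB, hpA, hyB, hAB⟩ := t2_separation hne
        have hqB : q ∈ ψ '' (B ∩ (U : Set 𝒟'.carrier)) := ⟨y₀.1, ⟨hyB, y₀.2⟩, hqy₀⟩
        obtain ⟨y, hyU, hyA, b, ⟨hbB, hbU⟩, hb⟩ := hcorr A (hA.mem_nhds hpA) _ ((hopen B hB).mem_nhds hqB)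
        have hyb : b = y := hinjOn hbU hyU hb
        exact (Set.disjoint_left.1 hAB) hyA (hyb ▸ hbB)
      exact hpU (hpy₀ ▸ y₀.2)
  obtain ⟨V', hV', hlt⟩ := h12 R 𝔞 ⟨p, ⟨q, hqV⟩, hpair⟩
  obtain ⟨ψ', hψ'i, hψ'τ, hψ'ι⟩ := hV'.exists_isIsometricImmersion
  have hvali : R.metric.IsIsometricImmersion 𝒟.metric.toPseudoRiemannianMetric
      (Subtype.val : V₁ → 𝒟.carrier) := by
    refine ⟨contMDiff_subtype_val, fun z ↦ ?_⟩
    ext a b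
    show 𝒟.metric.val z.1 (mfderiv (𝓡 (n + 1)) (𝓡 (n + 1)) (Subtype.val : V₁ → 𝒟.carrier) z a)
      (mfderiv (𝓡 (n + 1)) (𝓡 (n + 1)) (Subtype.val : V₁ → 𝒟.carrier) z b) = 𝒟.metric.val z.1 a b
    rw [mfderiv_subtypeVal]
    rfl
  have hvalτ : R.timeOrientation.PreservesTimeOrientation (Subtype.val : V₁ → 𝒟.carrier)
      𝒟.timeOrientation := fun z ↦ by
    show 𝒟.timeOrientation.IsFutureDirected
      (mfderiv (𝓡 (n + 1)) (𝓡 (n + 1)) (Subtype.val : V₁ → 𝒟.carrier) z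
        (𝒟.timeOrientation.vectorField z.1))
    rw [mfderiv_subtypeVal]
    exact 𝒟.timeOrientation.isFutureDirected_vectorField z.1
  classical
  let ψ'' : 𝒟'.carrier → 𝒟.carrier := fun x ↦
    if hx : x ∈ V' then ((ψ' ⟨x, hx⟩ : V₁) : 𝒟.carrier) else ψ x
  have hψ''_of_mem : ∀ (x : 𝒟'.carrier) (hx : x ∈ V'), ψ'' x = ((ψ' ⟨x, hx⟩ : V₁) : 𝒟.carrier) :=
    fun x hx ↦ by
      show (if hx : x ∈ V' then ((ψ' ⟨x, hx⟩ : V₁) : 𝒟.carrier) else ψ x) = _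
      rw [dif_pos hx]
  have hPV' := relCGHD_of_isCommonDevelopment 𝒟 hΦ hΦ' 𝒟' R Subtype.val contMDiff_subtype_val hvali
    hvalτ rfl hV' hψ'i hψ'τ hψ'ι hψ''_of_mem
  have hEq : EqOn ψ ψ'' U := by
    intro y hy
    have hyV' : y ∈ V' := hlt.le hy
    have h := h𝔞U.apply_eq_apply hV' 𝔞.isIsometricImmersion 𝔞.preservesTimeOrientation
      𝔞.map_comp_embedOpens hψ'i hψ'τ hψ'ι hy hyV'
    rw [hψ''_of_mem y hyV']
    exact congrArg Subtype.val h
  have hVU : V' = U := hUmax V' ψ'' hPV' hlt.le hEq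
  rw [hVU] at hlt
  exact lt_irrefl _ hlt

/-- **Hypothesis `hncb` of `subdataDevelopmentsEmbed_of_localTheory_of_cauchyRegion_of_ncb` from the
same-data Theorem 12**, the global-hyperbolicity consequences and the slab condition, each for all
vacuum Cauchy developments (dimension `3 + 1`); the maximality of `𝒟` is not used. [cite: Sbierski2016AHP, §3.2, Thm. 12 and §3.3 (arXiv numbering); HawkingEllis1973CUP, §7.6, p. 250] -/
theorem hncb_of_thm12
    (h12 : ∀ (N : Type) [TopologicalSpace N] [ChartedSpace E3 N] [IsManifold (𝓡 3) ∞ N]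
      [ConnectedSpace N] (D₁ : InitialDataSet (𝓡 3) N) (𝒟₁ 𝒟₂ : VacuumCauchyDevelopment D₁)
      (𝔠 : CauchyDevelopment.CommonDevelopment 𝒟₁.toCauchyDevelopment 𝒟₂.toCauchyDevelopment),
      𝔠.HasCorrespondingBoundaryPoints →
        ∃ V : Opens 𝒟₁.carrier,
          𝒟₁.toCauchyDevelopment.IsCommonDevelopment 𝒟₂.toDataEmbedding V ∧ 𝔠.opens < V)
    (hGH : ∀ (X : Type) [TopologicalSpace X] [ChartedSpace E3 X] [IsManifold (𝓡 3) ∞ X]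
      [ConnectedSpace X] (D : InitialDataSet (𝓡 3) X) (𝒟 : VacuumCauchyDevelopment D),
      (∀ x : 𝒟.carrier, IsCompact (𝒟.metric.causalPast 𝒟.timeOrientation {x} ∩
        𝒟.metric.causalFuture 𝒟.timeOrientation (range 𝒟.embed))) ∧
      (∀ x : 𝒟.carrier, IsCompact (𝒟.metric.causalFuture 𝒟.timeOrientation {x} ∩
        𝒟.metric.causalPast 𝒟.timeOrientation (range 𝒟.embed))) ∧
      (∀ (xs ys : ℕ → 𝒟.carrier) (x y : 𝒟.carrier), Tendsto xs atTop (𝓝 x) →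
        Tendsto ys atTop (𝓝 y) →
        (∀ j, ys j ∈ 𝒟.metric.causalFuture 𝒟.timeOrientation {xs j}) →
        y ∈ 𝒟.metric.causalFuture 𝒟.timeOrientation {x}))
    (hslab : ∀ (X : Type) [TopologicalSpace X] [ChartedSpace E3 X] [IsManifold (𝓡 3) ∞ X]
      [ConnectedSpace X] (D : InitialDataSet (𝓡 3) X) (𝒟 : VacuumCauchyDevelopment D),
      ∀ a ∈ range 𝒟.embed, ∃ ν : TangentSpace (𝓡 4) a,
        𝒟.metric.IsTimelike ν ∧ 𝒟.timeOrientation.IsFutureDirected ν ∧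
        ∀ κ : ℝ, 0 < κ → ∀ᶠ σ in 𝓝 a, σ ∈ range 𝒟.embed →
          |𝒟.metric.val a ν (extChartAt (𝓡 4) a σ - extChartAt (𝓡 4) a a)| ≤
            κ * ‖extChartAt (𝓡 4) a σ - extChartAt (𝓡 4) a a‖) :
    ∀ (X : Type) [TopologicalSpace X] [ChartedSpace E3 X] [IsManifold (𝓡 3) ∞ X]
      [T2Space X] [SecondCountableTopology X] [ConnectedSpace X] (D : InitialDataSet (𝓡 3) X)
      (𝒟 : VacuumCauchyDevelopment D), 𝒟.IsMaximal →
      ∀ (N : Type) [TopologicalSpace N] [ChartedSpace E3 N] [IsManifold (𝓡 3) ∞ N]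
      [ConnectedSpace N] (Φ : N → X) (hΦ : ContMDiff (𝓡 3) (𝓡 3) (∞ + 1) Φ)
      (hΦ' : ∀ u, Injective (mfderiv (𝓡 3) (𝓡 3) Φ u)), IsOpenEmbedding Φ →
      ∀ (𝒟' : VacuumCauchyDevelopment (D.comap Φ hΦ hΦ')) (U : Opens 𝒟'.carrier)
        (ψ : 𝒟'.carrier → 𝒟.carrier),
        ((∀ u, 𝒟'.embed u ∈ U) ∧ IsConnected (U : Set 𝒟'.carrier) ∧
        (𝒟'.metric.restrict PseudoRiemannianMetric.contMDiff_restrict_holds U).IsCauchyHypersurface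
          (𝒟'.timeOrientation.restrict PseudoRiemannianMetric.contMDiff_restrict_holds
            𝒟'.timeOrientation.contMDiff_restrict_holds U) (Subtype.val ⁻¹' range 𝒟'.embed) ∧
        ContMDiffOn (𝓡 4) (𝓡 4) ∞ ψ U ∧
        (∀ p ∈ U, pullbackBilin (I := 𝓡 4) (I' := 𝓡 4) ψ 𝒟.metric.val p = 𝒟'.metric.val p) ∧
        (∀ p ∈ U, 𝒟.timeOrientation.IsFutureDirected
          (mfderiv (𝓡 4) (𝓡 4) ψ p (𝒟'.timeOrientation.vectorField p))) ∧
        ψ ∘ 𝒟'.embed = 𝒟.embed ∘ Φ) →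
        (∀ (U' : Opens 𝒟'.carrier) (ψ' : 𝒟'.carrier → 𝒟.carrier),
          ((∀ u, 𝒟'.embed u ∈ U') ∧ IsConnected (U' : Set 𝒟'.carrier) ∧
          (𝒟'.metric.restrict PseudoRiemannianMetric.contMDiff_restrict_holds
              U').IsCauchyHypersurface
            (𝒟'.timeOrientation.restrict PseudoRiemannianMetric.contMDiff_restrict_holds
              𝒟'.timeOrientation.contMDiff_restrict_holds U') (Subtype.val ⁻¹' range 𝒟'.embed) ∧
          ContMDiffOn (𝓡 4) (𝓡 4) ∞ ψ' U' ∧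
          (∀ p ∈ U', pullbackBilin (I := 𝓡 4) (I' := 𝓡 4) ψ' 𝒟.metric.val p = 𝒟'.metric.val p) ∧
          (∀ p ∈ U', 𝒟.timeOrientation.IsFutureDirected
            (mfderiv (𝓡 4) (𝓡 4) ψ' p (𝒟'.timeOrientation.vectorField p))) ∧
          ψ' ∘ 𝒟'.embed = 𝒟.embed ∘ Φ) →
          U ≤ U' → EqOn ψ ψ' U → U' = U) →
        ∀ p ∈ frontier (U : Set 𝒟'.carrier), ∀ q : 𝒟.carrier,
          ¬ ClusterPt q (map ψ (𝓝[(U : Set 𝒟'.carrier)] p)) := by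
  intro X _ _ _ _ _ _ D 𝒟 _ N _ _ _ _ Φ hΦ hΦ' hΦo 𝒟' U ψ hP hUmax p hp q
  obtain ⟨hK, hK', hrel⟩ := hGH X D 𝒟
  obtain ⟨hK₁, hK₁', -⟩ := hGH N (D.comap Φ hΦ hΦ') 𝒟'
  exact not_clusterPt_of_thm12 𝒟 hΦ hΦ' hΦo 𝒟' (fun R 𝔠 h ↦ h12 N (D.comap Φ hΦ hΦ') 𝒟' R 𝔠 h)
    hK hK' hK₁ hK₁' (fun hx hy h ↦ hrel _ _ _ _ hx hy h) (hslab X D 𝒟) U ψ hP hUmax hp q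

end SubdataDevelopmentsEmbed

end Summit.FinalStateConjecture.FinalStateConjecture.Theorems
end
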